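import Summits.QuantumAdvantage.QuantumAdvantage.Theorems.SosSandwichTransferPBWalkDefs
import HarnessLib

/-!
# Route `SosSandwich`, crux `TransferPB` (stmt-QuantumAdvantage-15238): the machine half as an EVENT-DRIVEN STATE MACHINE (definitions)

`Defs` file (D-0016 convention; no theorem proved here). The implementation statement left by
`Theorems/SosSandwichTransferPBDescentWalk.lean` (`stub_pbOracleSimulation_of_stringMachines`) asks for ONE
transcript machine `C : OracleAlg Bool` with a polynomial-time step function, short queries, and runs
`C^{A ⊕ g}(x) = [20 ≤ meanCount g x (strWalk g x W' 𝟙_A D [])]`. The reference machine `walkMachine`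
(`Theorems/SosSandwichTransferPBWalkMachineDefs.lean`) has the right runs, but its polynomial TIME is the programming
fact (P') about a five-fold nested replay. This file gives a SECOND machine for the same runs, presented as a
STATE MACHINE that consumes ONE answer bit per transition — the shape of the tree's toolkit
`Literature/Computability/Complexity/OracleStateMachine.lean` (`OSM`: three string maps `ini/del/kap`, and
`OSM.isPolyTime_alg`: polynomial time from `ini, del, kap ∈ FP` with additively growing states, NO loop to write):

* `EvPhase`, `EvState` — the state: string path `π`, remaining round budget `d`, and the phase
  (`root`: the BLOCK test of `[]` is pending; `single lv alive next best`: the SINGLE test of `alive.head` is pending,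
  `lv` levels remain below the current one, `next` collects the live children, `best` is the least candidate so far;
  `block0`/`block1`: the BLOCK tests of the two children are pending; `aq u`: the `A`-query of the pick `u` is pending;
  `means j cnt`: the `j`-th MEAN test is pending, `cnt` answered `true` so far; `done b`: output `b`);
* `better`, `bump`, `finish`, `proceed`, **`evDelta W s b`** (the transition on the answer bit `b`), **`evKappa x s`** (the
  pending query, or the output), `roundState` / **`evInit D`**, **`evLoop`** (the abstract interaction, fuelled —
  the shape of `OSM.loop`), `evState` (the state after given answer bits — the shape of `OSM.state`),
  **`EvInv W D`** (the size invariant of reachable states) and `evQueryBound` (the query-length budget it yields);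
* the functional bookkeeping the simulation is phrased in: `children` (one level of the heavy-prefix descent,
  cf. `liveLevel`), `levelsFrom`, `bestFold`, `scanCost`.

Within a round the machine enumerates the candidate list `descentCands` of `Theorems/SosSandwichTransferPBDescentDefs.lean`
EXACTLY (level by level, children `u0` before `u1`) and keeps the running `List.argmin strNum`; its queries differ
from the reference machine's (no level is recomputed), its RUNS are the same function `strWalk`/`meanCount`
(`Theorems/SosSandwichTransferPBEventMachine.lean`).
Sources: S. Aaronson, A. Ambainis, Theory Comput. 10 (2014), proof of Thm. 23 (p. 14); S. Arora, B. Barak,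
Computational Complexity (CUP 2009), §3.4 (oracle machines: the configuration after each answer).
-/

-- D-0017: single-conjunct summit ⇒ the duplicate `QuantumAdvantage.QuantumAdvantage` is mandated.
set_option linter.dupNamespace false

noncomputable section

namespace Summit.QuantumAdvantage.QuantumAdvantage.Cruxes.TransferPB.Birth

open Finset Literature.Computability.Cryptography Literature.Computability.Complexity
  Literature.Computability.QuantumComplexity Literature.Computability.QuantumComplexity.ClassicalSimulation

namespace SimTreePB

/-! ### States -/

/-- The phases of the event machine (see the module docstring). -/
inductive EvPhase
  /-- the BLOCK test of the empty prefix is pending (start of a round) -/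
  | root
  /-- the SINGLE test of `alive.head` is pending; `lv` levels remain below; `next` = live children found so far;
  `best` = least candidate so far -/
  | single (lv : ℕ) (alive next : List (List Bool)) (best : Option (List Bool))
  /-- the BLOCK test of the child `alive.head ++ [false]` is pending -/
  | block0 (lv : ℕ) (alive next : List (List Bool)) (best : Option (List Bool))
  /-- the BLOCK test of the child `alive.head ++ [true]` is pending -/
  | block1 (lv : ℕ) (alive next : List (List Bool)) (best : Option (List Bool))
  /-- the `A`-query of the picked string `u` is pending -/
  | aq (u : List Bool)
  /-- the `j`-th MEAN test is pending, `cnt` MEAN tests answered `true` so far -/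
  | means (j cnt : ℕ)
  /-- the run is over with output `b` -/
  | done (b : Bool)

/-- A state of the event machine: the string path revealed so far, the remaining round budget, the phase. -/
structure EvState where
  /-- the string path `π` (revealed string, revealed bit) -/
  path : List (List Bool × Bool)
  /-- the remaining round budget -/
  budget : ℕ
  /-- the phase -/
  phase : EvPhase

/-! ### Transitions -/

/-- Running `List.argmin strNum`: keep the least canonical number (the earlier one on ties), cf. `List.argmin_concat`. -/
def better : Option (List Bool) → List Bool → Option (List Bool)
  | none, u => some u
  | some c, u => if strNum u < strNum c then some u else some c

/-- The update of the running least candidate by the SINGLE answer `b` for the live string `u` at path `π`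
(a candidate must be answered `true` and must not be revealed on `π` already). -/
def bump (π : List (List Bool × Bool)) (b : Bool) (best : Option (List Bool)) (u : List Bool) : Option (List Bool) :=
  if b = true ∧ u ∉ π.map Prod.fst then better best u else best

/-- End of the descent of a round at path `π` with budget `d`: no candidate — the walk is over, go to the MEAN
tests (budget cleared); a pick `u` — ask the oracle `A` about `u`. -/
def finish (π : List (List Bool × Bool)) (d : ℕ) : Option (List Bool) → EvState
  | none => ⟨π, 0, .means 1 0⟩
  | some u => ⟨π, d, .aq u⟩

/-- After a live string has been fully processed: continue with the rest of the level; at the end of a level descend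
to the collected children (or finish if no level remains or no child is live). -/
def proceed (π : List (List Bool × Bool)) (d : ℕ) :
    ℕ → List (List Bool) → List (List Bool) → Option (List Bool) → EvState
  | lv, w :: rest, next, best => ⟨π, d, .single lv (w :: rest) next best⟩
  | 0, [], _, best => finish π d best
  | _ + 1, [], [], best => finish π d best
  | lv + 1, [], v :: next, best => ⟨π, d, .single lv (v :: next) [] best⟩

/-- The state at the start of a round with budget `d` at path `π` (budget `0`: the MEAN tests). -/
def roundState (π : List (List Bool × Bool)) : ℕ → EvState
  | 0 => ⟨π, 0, .means 1 0⟩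
  | d + 1 => ⟨π, d + 1, .root⟩

/-- **The transition of the event machine** with width bound `W` on the answer bit `b` (the strings already
revealed on the path are excluded from the candidates, as in `descentCands`). -/
def evDelta (W : ℕ) (s : EvState) (b : Bool) : EvState :=
  match s with
  | ⟨π, d, .root⟩ =>
    if W = 0 then finish π d none
    else if b = true then ⟨π, d, .single (W - 1) [[]] [] none⟩ else finish π d none
  | ⟨π, d, .single 0 (u :: rest) next best⟩ => proceed π d 0 rest next (bump π b best u)
  | ⟨π, d, .single (lv + 1) (u :: rest) next best⟩ => ⟨π, d, .block0 (lv + 1) (u :: rest) next (bump π b best u)⟩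
  | ⟨π, d, .block0 lv (u :: rest) next best⟩ =>
    ⟨π, d, .block1 lv (u :: rest) (if b = true then next ++ [u ++ [false]] else next) best⟩
  | ⟨π, d, .block1 lv (u :: rest) next best⟩ =>
    proceed π d lv rest (if b = true then next ++ [u ++ [true]] else next) best
  | ⟨π, d, .aq u⟩ => roundState (π ++ [(u, b)]) (d - 1)
  | ⟨π, d, .means j cnt⟩ =>
    let cnt' := if b = true then cnt + 1 else cnt
    if 40 ≤ j then ⟨π, d, .done (decide (20 ≤ cnt'))⟩ else ⟨π, d, .means (j + 1) cnt'⟩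
  | s => s

/-- **The action of a state** on input `x`: the pending query (`true :: instance` to the answer function,
`false :: u` to the oracle `A`), or the output bit. -/
def evKappa (x : List Bool) (s : EvState) : List Bool ⊕ Bool :=
  match s with
  | ⟨π, _, .root⟩ => Sum.inl (true :: encBlockS x π [])
  | ⟨π, _, .single _ (u :: _) _ _⟩ => Sum.inl (true :: encSingleS x π u)
  | ⟨π, _, .block0 _ (u :: _) _ _⟩ => Sum.inl (true :: encBlockS x π (u ++ [false]))
  | ⟨π, _, .block1 _ (u :: _) _ _⟩ => Sum.inl (true :: encBlockS x π (u ++ [true]))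
  | ⟨_, _, .aq u⟩ => Sum.inl (false :: u)
  | ⟨π, _, .means j _⟩ => Sum.inl (true :: encMeanS x π j)
  | ⟨_, _, .done b⟩ => Sum.inr b
  | _ => Sum.inr false

/-- **The initial state** for the round budget `D`. -/
def evInit (D : ℕ) : EvState := roundState [] D

/-- **The abstract interaction** of the event machine (input `x`, width bound `W`) with an oracle given as the
bit-valued function `O` on queries, with fuel: the shape of `OSM.loop`. -/
def evLoop (x : List Bool) (W : ℕ) (O : List Bool → Bool) : ℕ → EvState → Option Bool
  | 0, _ => none
  | n + 1, s =>
    match evKappa x s with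
    | Sum.inl q => evLoop x W O n (evDelta W s (O q))
    | Sum.inr b => some b

/-- The state reached from `evInit D` on the answer bits `bits` (the shape of `OSM.state`). -/
def evState (W D : ℕ) (bits : List Bool) : EvState :=
  bits.foldl (evDelta W) (evInit D)

/-- **Size invariant of the reachable states** (width bound `W`, round budget `D`): every string in play is shorter
than `W` (live strings by as much as the number of levels still below them), the path and the remaining budget
together fit in `D`, query phases have a positive budget, MEAN indices lie in `1 … 40`. It bounds the query lengths
and keeps the caps of an `FP` implementation of `evDelta` inactive. -/
def EvInv (W D : ℕ) (s : EvState) : Prop :=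
  (∀ e ∈ s.path, e.1.length < W) ∧ s.path.length + s.budget ≤ D ∧
    match s.phase with
    | .root => 1 ≤ s.budget
    | .single lv alive next best | .block0 lv alive next best | .block1 lv alive next best =>
      1 ≤ s.budget ∧ (∀ u ∈ alive, u.length + lv < W) ∧ (∀ v ∈ next, v.length + lv ≤ W) ∧
        (∀ c, best = some c → c.length < W)
    | .aq u => 1 ≤ s.budget ∧ u.length < W
    | .means j cnt => 1 ≤ j ∧ j ≤ 40 ∧ cnt ≤ 40
    | .done _ => True

/-- The query-length budget of the event machine: `2|x| + 2·D·(2W+4) + W + 50`. -/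
def evQueryBound (W D n : ℕ) : ℕ := 2 * n + 2 * D * (2 * W + 4) + W + 50

/-! ### Functional bookkeeping of a round -/

/-- One level of the heavy-prefix descent: the live children of the live strings (so that
`liveLevel blk (j+1) = children blk (liveLevel blk j)`). -/
def children (blk : List Bool → Bool) (alive : List (List Bool)) : List (List Bool) :=
  alive.flatMap fun u => [u ++ [false], u ++ [true]].filter fun v => blk v = true

/-- The strings of the current level `alive` and of the `lv` levels below it, level by level. -/
def levelsFrom (blk : List Bool → Bool) : List (List Bool) → ℕ → List (List Bool)
  | alive, 0 => alive
  | alive, lv + 1 => alive ++ levelsFrom blk (children blk alive) lv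

/-- The running least candidate after scanning the strings `l` (single test `sgl`, revealed strings `used`). -/
def bestFold (sgl : List Bool → Bool) (used : List (List Bool)) (best : Option (List Bool)) (l : List (List Bool)) :
    Option (List Bool) :=
  l.foldl (fun best u => if sgl u = true ∧ u ∉ used then better best u else best) best

/-- The number of queries of the level scan started at `alive` with `lv` levels below. -/
def scanCost (blk : List Bool → Bool) : List (List Bool) → ℕ → ℕ
  | alive, 0 => alive.length
  | alive, lv + 1 => 3 * alive.length + (if children blk alive = [] then 0 else scanCost blk (children blk alive) lv)

end SimTreePB

end Summit.QuantumAdvantage.QuantumAdvantage.Cruxes.TransferPB.Birth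

end
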